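import Summits.CriticalPhenomena.Ising3DConformalLimit.Theorems.PerfectScreeningCoulombImpliesNontrivialOfUpperCriticalIsotherm
import Summits.CriticalPhenomena.Ising3DConformalLimit.Theorems.PerfectScreeningCoulombImpliesNontrivialTiltedMeanBelowFirstZero
import Summits.CriticalPhenomena.Ising3DConformalLimit.Theorems.PerfectScreeningCoulombImpliesNontrivialSuperIsothermOfVanishingBinder

/-!
# `CoulombImpliesNontrivial` from the upper critical isotherm ALONG ONE SEQUENCE (line `SketchPub` v9, lead c2)

Crux `CoulombImpliesNontrivial` of route `PerfectScreening` (Ising3DConformalLimit), item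
stmt-CriticalPhenomena-13885: `Coulomb lower bound c/‖x‖ ≤ ⟨σ₀σ_x⟩_{β_c} ⟹ every non-degenerate pointwise
scaling limit of criticalCorr 3 has U₄ ≢ 0`.

This file (PART A of the v9 reductions) reshapes the sorry-free assembly of line `SketchPub` (cf. `stub_cruxOfUpperCriticalIsotherm`, which needed
the upper critical isotherm for ALL small fields) so that the residual hypothesis is strictly weaker:

  `R := Coulomb → ∃ A, ∃ᶠ h → 0⁺, m(β_c(3), h) ≤ A·h^{1/5}`

(the upper critical isotherm along ONE sequence `h_k → 0`, i.e. `liminf_{h→0⁺} m(β_c,h)·h^{-1/5} < ∞`).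
The gain comes from using the contradiction hypothesis INSIDE the isotherm analysis: a non-degenerate Gaussian
limit kills the block Binder cumulant, `g_L := (3Σ_L² − ⟨M_L⁴⟩)/Σ_L² → 0` (S7 `stub_gaussianKillsBinder`, with the
two-sided `L⁵` variance S4 `stub_blockVariance`); by Newman's first-zero bound every Lee–Yang mode of the block is
then `o(Σ_L)`, so the block responds LINEARLY (Gaussian-like) to a block field up to `t√Σ_L → ∞`
(T1a `stub_tiltedMeanBelowFirstZero`), and GKS block-field domination (S3) turns that into a SUPER-isotherm
`m(β_c,h)·h^{-1/5} → ∞` (T1b `stub_superIsothermOfVanishingBinder`) — which R forbids.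
* `sketchPub_superIsotherm_of_vanishingBinder` — `cL⁵ ≤ Σ_L ≤ CL⁵` and `g_L → 0` ⟹ `∀ A, m(β_c,h) > A h^{1/5}`
  for all small `h`.
* `sketchPub_binderNonvanishing_of_upperIsothermFrequently` — ZERO-FIELD READING of the residual: under the
  two-sided variance, R ⟹ `¬ (g_L → 0)` ("under Coulomb the critical block spin is not asymptotically Gaussian").
* `stub_cruxOfUpperIsothermFrequently` — R ⟹ `CoulombImpliesNontrivial`, by name (registered stub of the line's
  skeleton v9; the residual R itself, `stub_upperCriticalIsothermFrequently`, stays OPEN).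
* `sketchPub_upperIsothermFrequently_of_upperIsotherm` — the old residual (∀ small h) implies R, so every landed
  entrance to it (one-arm bound `stub_isothermOfOneArm`, field form `stub_upperIsothermOfSusceptibility`) is an
  entrance to R.

Companion file `PerfectScreeningCoulombImpliesNontrivialOfLeeYangGap.lean`: the EXISTING open crux `LeeYangGap.NearCriticalLeeYangGap` (stmt-CriticalPhenomena-4945) also
closes r3 (`stub_cruxOfNearCriticalLeeYangGap`); the `β = β_c` content of 4945 is exactly `¬(g_L → 0)`, which R
implies (`sketchPub_binderNonvanishing_of_upperIsothermFrequently` below).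
-/

noncomputable section

namespace Summit.CriticalPhenomena.Ising3DConformalLimit.PerfectScreeningCoulombImpliesNontrivial

open Literature.Probability.LatticeModels Filter Set Finset
open scoped Topology BigOperators

/-- The critical block mgf is positive: `0 < ⟨e^{tM_L}⟩_{β_c} = cosh^m t ∏ᵢ(1 + bᵢ sinh² t)`. -/
theorem sketchPub_blockMgf_pos (L : ℕ) (t : ℝ) :
    0 < plusExpect 3 (criticalBeta 3) 0 (fun σ => Real.exp (t * ∑ x ∈ box 3 L, spinAt x σ)) := by
  obtain ⟨m, n, b, hb, -, -, hexp, -, -, -⟩ := sketchPub_blockPackage L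
  rw [hexp t]
  refine mul_pos (pow_pos (Real.cosh_pos t) m) (Finset.prod_pos fun i _ => ?_)
  have := hb i
  positivity

/-- T1a on the critical block: below the first Lee–Yang zero the tilted block mean is at least half the linear
response, `t Σ_L/2 ≤ ⟨M_L e^{tM_L}⟩/⟨e^{tM_L}⟩`, whenever `0 ≤ t ≤ 1` and `π² √((3Σ_L² − ⟨M_L⁴⟩)/12)·sinh² t ≤ 2`
(package `sketchPub_blockPackage` = S1a + S1b, Newman's first-zero bound, `stub_tiltedMeanBelowFirstZero`). -/
theorem sketchPub_blockTiltedMean_ge (L : ℕ) (t : ℝ) (ht0 : 0 ≤ t) (ht1 : t ≤ 1)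
    (hcond : Real.pi ^ 2 * Real.sqrt ((3 * (plusExpect 3 (criticalBeta 3) 0
        (fun σ => (∑ x ∈ box 3 L, spinAt x σ) ^ 2)) ^ 2 -
        plusExpect 3 (criticalBeta 3) 0 (fun σ => (∑ x ∈ box 3 L, spinAt x σ) ^ 4)) / 12) *
        Real.sinh t ^ 2 ≤ 2) :
    t * plusExpect 3 (criticalBeta 3) 0 (fun σ => (∑ x ∈ box 3 L, spinAt x σ) ^ 2) / 2 ≤
      plusExpect 3 (criticalBeta 3) 0
          (fun σ => (∑ x ∈ box 3 L, spinAt x σ) * Real.exp (t * ∑ x ∈ box 3 L, spinAt x σ)) /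
        plusExpect 3 (criticalBeta 3) 0 (fun σ => Real.exp (t * ∑ x ∈ box 3 L, spinAt x σ)) := by
  have hEpos := sketchPub_blockMgf_pos L t
  obtain ⟨m, n, b, hb, -, hcos, hexp, htilt, hvar, hN⟩ := sketchPub_blockPackage L
  have hzero : ∀ θ : ℝ, 0 < θ → Real.cos θ ^ m * ∏ i, (1 - b i * Real.sin θ ^ 2) = 0 →
      12 / θ ^ 4 ≤ 3 * (plusExpect 3 (criticalBeta 3) 0 (fun σ => (∑ x ∈ box 3 L, spinAt x σ) ^ 2)) ^ 2 -
        plusExpect 3 (criticalBeta 3) 0 (fun σ => (∑ x ∈ box 3 L, spinAt x σ) ^ 4) := by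
    intro θ hθ hprod
    refine hN θ hθ ?_
    rw [hcos θ, hprod]
  have hT1a := stub_tiltedMeanBelowFirstZero m n b _ t hb hzero ht0 ht1 hcond
  rw [hvar] at hT1a
  rw [hexp t] at hEpos ⊢
  rw [htilt t, mul_div_assoc, mul_div_cancel_left₀ _ hEpos.ne']
  convert hT1a using 1
  ring

/-- **The super-isotherm of a Gaussian limit.** If `cL⁵ ≤ Σ_L ≤ CL⁵` (`L ≥ 1`) and the critical block Binder
cumulant `g_L = (3Σ_L² − ⟨M_L⁴⟩)/Σ_L²` tends to `0`, then `m(β_c,h)·h^{-1/5} → ∞` as `h → 0⁺`: for every `A`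
there is `h₀ > 0` with `A·h^{1/5} < m(β_c,h)` on `(0,h₀]` (T1b fed by T1a, the package and GKS block-field
domination S3). -/
theorem sketchPub_superIsotherm_of_vanishingBinder
    (hV : ∃ c C : ℝ, 0 < c ∧ ∀ L : ℕ, 1 ≤ L →
        c * (L : ℝ) ^ 5 ≤ plusExpect 3 (criticalBeta 3) 0 (fun σ => (∑ x ∈ box 3 L, spinAt x σ) ^ 2) ∧
        plusExpect 3 (criticalBeta 3) 0 (fun σ => (∑ x ∈ box 3 L, spinAt x σ) ^ 2) ≤ C * (L : ℝ) ^ 5)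
    (htend : Tendsto (fun L : ℕ =>
        (3 * (plusExpect 3 (criticalBeta 3) 0 (fun σ => (∑ x ∈ box 3 L, spinAt x σ) ^ 2)) ^ 2 -
            plusExpect 3 (criticalBeta 3) 0 (fun σ => (∑ x ∈ box 3 L, spinAt x σ) ^ 4)) /
          (plusExpect 3 (criticalBeta 3) 0 (fun σ => (∑ x ∈ box 3 L, spinAt x σ) ^ 2)) ^ 2)
        atTop (𝓝 0)) :
    ∀ A : ℝ, ∃ h₀ : ℝ, 0 < h₀ ∧ ∀ h : ℝ, 0 < h → h ≤ h₀ →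
      A * h ^ ((1:ℝ) / 5) < magnetizationInField 3 (criticalBeta 3) h :=
  stub_superIsothermOfVanishingBinder (criticalBeta 3) (criticalBeta_pos_holds (d := 3) (by norm_num))
    (fun L => plusExpect 3 (criticalBeta 3) 0 (fun σ => (∑ x ∈ box 3 L, spinAt x σ) ^ 2))
    (fun L => 3 * (plusExpect 3 (criticalBeta 3) 0 (fun σ => (∑ x ∈ box 3 L, spinAt x σ) ^ 2)) ^ 2 -
      plusExpect 3 (criticalBeta 3) 0 (fun σ => (∑ x ∈ box 3 L, spinAt x σ) ^ 4))
    (magnetizationInField 3 (criticalBeta 3))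
    (fun L t => plusExpect 3 (criticalBeta 3) 0 (fun σ => Real.exp (t * ∑ x ∈ box 3 L, spinAt x σ)))
    (fun L t => plusExpect 3 (criticalBeta 3) 0
      (fun σ => (∑ x ∈ box 3 L, spinAt x σ) * Real.exp (t * ∑ x ∈ box 3 L, spinAt x σ)))
    sketchPub_blockMgf_pos sketchPub_blockTiltedMean_ge
    (fun L h hh => stub_blockFieldDomination L h hh) hV htend

/-- **Zero-field reading of the residual.** Under the two-sided `L⁵` block variance, the residual R — an upper
critical-isotherm bound `m(β_c,h) ≤ A h^{1/5}` along one sequence of fields — says exactly that the critical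
block Binder cumulant does NOT tend to zero (contrapositive of the super-isotherm). -/
theorem sketchPub_binderNonvanishing_of_upperIsothermFrequently
    (hV : ∃ c C : ℝ, 0 < c ∧ ∀ L : ℕ, 1 ≤ L →
        c * (L : ℝ) ^ 5 ≤ plusExpect 3 (criticalBeta 3) 0 (fun σ => (∑ x ∈ box 3 L, spinAt x σ) ^ 2) ∧
        plusExpect 3 (criticalBeta 3) 0 (fun σ => (∑ x ∈ box 3 L, spinAt x σ) ^ 2) ≤ C * (L : ℝ) ^ 5)
    (hR : ∃ A : ℝ, ∃ᶠ h in 𝓝[>] (0:ℝ),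
        magnetizationInField 3 (criticalBeta 3) h ≤ A * h ^ ((1:ℝ) / 5)) :
    ¬ Tendsto (fun L : ℕ =>
        (3 * (plusExpect 3 (criticalBeta 3) 0 (fun σ => (∑ x ∈ box 3 L, spinAt x σ) ^ 2)) ^ 2 -
            plusExpect 3 (criticalBeta 3) 0 (fun σ => (∑ x ∈ box 3 L, spinAt x σ) ^ 4)) /
          (plusExpect 3 (criticalBeta 3) 0 (fun σ => (∑ x ∈ box 3 L, spinAt x σ) ^ 2)) ^ 2)
        atTop (𝓝 0) := by
  intro htend
  obtain ⟨A, hfreq⟩ := hR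
  obtain ⟨h₀, hh₀, hsuper⟩ := sketchPub_superIsotherm_of_vanishingBinder hV htend A
  refine hfreq ?_
  filter_upwards [Ioc_mem_nhdsGT hh₀] with h hh
  exact not_le.2 (hsuper h hh.1 hh.2)

/-- **The crux from the residual R** (line `SketchPub` v8 assembled, sorry-free): the upper critical isotherm
ALONG ONE SEQUENCE under the Coulomb antecedent, `Coulomb → ∃ A, ∃ᶠ h → 0⁺, m(β_c(3),h) ≤ A h^{1/5}`, implies
`CoulombImpliesNontrivial` — by name. (Under Coulomb take a non-degenerate pointwise limit with `U₄ ≡ 0`; S4 + S7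
give `g_L → 0`; the super-isotherm (T1a, T1b, package, S3) then contradicts R.) -/
theorem stub_cruxOfUpperIsothermFrequently :
    ((∃ c : ℝ, 0 < c ∧ ∀ x : Site 3, x ≠ 0 → c / ‖x‖ ≤ criticalTwoPoint 3 x) →
      ∃ A : ℝ, ∃ᶠ h in 𝓝[>] (0:ℝ),
        magnetizationInField 3 (criticalBeta 3) h ≤ A * h ^ ((1:ℝ) / 5)) →
    Summit.CriticalPhenomena.Ising3DConformalLimit.Theses.PerfectScreening.CoulombImpliesNontrivial := by
  intro hR hC ρ S hρ hlim hnd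
  by_contra hU4
  have hV := stub_blockVariance hC
  have htend := stub_gaussianKillsBinder hV ρ S hρ hlim hnd hU4
  exact sketchPub_binderNonvanishing_of_upperIsothermFrequently hV (hR hC) htend

/-- The old residual S6 (upper critical isotherm for ALL small `h`) implies the new residual R (along a
sequence): `𝓝[>] 0` is non-trivial and contains `(0, h₀]`. Hence each landed entrance to S6 — the one-arm bound
(`stub_isothermOfOneArm`) and the field form (`stub_upperIsothermOfSusceptibility`) — is an entrance to R, and
`stub_cruxOfUpperCriticalIsotherm` is a corollary of `stub_cruxOfUpperIsothermFrequently`. -/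
theorem sketchPub_upperIsothermFrequently_of_upperIsotherm
    (hS6 : ∃ A h₀ : ℝ, 0 < h₀ ∧ ∀ h : ℝ, 0 < h → h ≤ h₀ →
        magnetizationInField 3 (criticalBeta 3) h ≤ A * h ^ ((1:ℝ) / 5)) :
    ∃ A : ℝ, ∃ᶠ h in 𝓝[>] (0:ℝ),
        magnetizationInField 3 (criticalBeta 3) h ≤ A * h ^ ((1:ℝ) / 5) := by
  obtain ⟨A, h₀, hh₀, hA⟩ := hS6
  refine ⟨A, Filter.Eventually.frequently ?_⟩
  filter_upwards [Ioc_mem_nhdsGT hh₀] with h hh using hA h hh.1 hh.2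

end Summit.CriticalPhenomena.Ising3DConformalLimit.PerfectScreeningCoulombImpliesNontrivial

end
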